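import Summits.MatrixMultiplication.OmegaCensus.STPPVosperSlackTwoCheckersG
import Summits.MatrixMultiplication.OmegaCensus.STPPVosperSlackTwoLawABT
import Summits.MatrixMultiplication.OmegaCensus.STPPVosperSlackTwoSoundCTools
import Summits.MatrixMultiplication.OmegaCensus.STPPVosperSlackTwoSoundCReduce

/-!
# ω-census (abelian STPP census): SOUNDNESS of the general pinned-sumset checker — normal form and the Hamidoune–Rødseth cell (kernel tool)

HONEST FRAMING (pub-omega census; verbatim): lottery ticket; floor = certified bounds/negative ranges.
Census STRUCTURE (seat pub-omega-stpp-1 gen 33, 2026-08-28), family (b2).  For the slack-4 programme on the fifth ℤ₆₁ leaf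
(HOME `pub-omega-stpp-1-g33/FIFTH-LEAF.md`):

* `caseGDeadT_false_of_normal_form_lists` : an STPP family of `ℤ/p` with `N ≥ 2` non-empty blocks, block `i` with value lists `P` (of `Aᵢ`), `Q` (of `Bᵢ`)
  and `Yo` (of `Y° = ⋃_{k≠i}(C_k − B_k)`) — ANY duplicate-free lists with the right members —, `#SY = sz`, other blocks `ks` of sizes `szs`, and a table
  of pairs all `CoverDead p N i szs`, makes `caseGDeadT p c z sz P Yo Q tbl` (`STPPVosperSlackTwoCheckersG.lean`) return `false`.  (The sumset mask
  `⋁_{x∈P} rot (maskOf Yo) (p−x)` IS `SY` by `tb_foldl_lor_rot_maskOf`; the rest is the argument of `caseADeadT_false_of_normal_form`.)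
* `negImage_add_DU_eq_image_affine` : under the normalisation `x ↦ u·x + (per-block shifts)`, `SY = (−Aᵢ) + Y°` is mapped by an affine bijection
  (so its cardinality is preserved).
* `caseGDeadT_false_of_HR` : the HAMIDOUNE–RØDSETH CELL `#SY = a + L` (`Aᵢ ⊆` an `(a+1)`-progression, `Y° ⊆` an `(L+1)`-progression of the same
  difference, `a + L < p`): for any base point `β₀` there are hole indices `h′ ∈ [1,a]`, `k ∈ [1,L]` with
  `caseGDeadT p c z (a+L) ([0,a]∖{h′}) ((a + [0,L])∖{a+k}) Q tbl = false` on the value list `Q` of `d⁻¹·(Bᵢ − β₀)` — reduction by the dilation `d⁻¹` and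
  the translations block-`i` (`Aᵢ`'s progression ↦ base `0`), global `B` (`β₀ ↦ 0`), global `C` (`Y°`'s progression ↦ base `a`).
UNCONDITIONAL; no `decide`.  Nothing here is progress on `ω`.

References: H. Cohn, R. Kleinberg, B. Szegedy, C. Umans, FOCS 2005 (arXiv:math/0511460), Def. 5.1; Y. O. Hamidoune, Ø. J. Rødseth, Acta Arith. 92 (2000).
-/

open Finset
open scoped Pointwise

namespace Summit.MatrixMultiplication.OmegaCensus.CubeNB.S2

open Literature.Computability.AlgebraicComplexity
open Literature.Combinatorics.Additive
open Summit.MatrixMultiplication.OmegaCensus.STPPKneser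
open Summit.MatrixMultiplication.OmegaCensus.CubeNB.Bits

variable {p : ℕ} [hp : Fact p.Prime]

/-! ## §1 Normal form -/

/-- **NORMAL-FORM SOUNDNESS of the general checker `caseGDeadT`.**  See the module docstring. [cite: CohnKleinbergSzegedyUmans2005, Def. 5.1] -/
theorem caseGDeadT_false_of_normal_form_lists {N : ℕ} {A B C : Fin N → Finset (ZMod p)} (hS : IsSTPP A B C)
    (hA : ∀ k, (A k).Nonempty) (hB : ∀ k, (B k).Nonempty) (hC : ∀ k, (C k).Nonempty) (i : Fin N)
    {c z sz : ℕ} (hc : #(C i) = c) (hz : ∑ k ∈ univ.erase i, #(A k) * #(C k) = z)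
    (hSY : #((A i).image (fun x => (0 : ZMod p) - x) + DU B C (univ.erase i)) = sz)
    (P Q Yo : List ℕ) (hPmem : ∀ v, v ∈ P ↔ ∃ x ∈ A i, x.val = v) (hPnd : P.Nodup) (hQmem : ∀ v, v ∈ Q ↔ ∃ x ∈ B i, x.val = v)
    (hQnd : Q.Nodup) (hYomem : ∀ v, v ∈ Yo ↔ ∃ e ∈ DU B C (univ.erase i), e.val = v) (hYond : Yo.Nodup)
    (ks : List (Fin N)) (hks : ks.Nodup) (hksi : ∀ k, k ∈ ks ↔ k ≠ i) {szs : List (ℕ × ℕ × ℕ)}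
    (hszs : ks.map (fun k => (#(A k), #(B k), #(C k))) = szs)
    {tbl : List (List ℕ × List ℕ)} (hdead : ∀ e ∈ tbl, CoverDead p N i szs e.1 e.2) :
    caseGDeadT p c z sz P Yo Q tbl = false := by
  rw [Bool.eq_false_iff]; intro h
  have hp0 : 0 < p := hp.out.pos
  have hQlt : ∀ q ∈ Q, q < p := fun q hq => by obtain ⟨x, _, rfl⟩ := (hQmem q).1 hq; exact x.val_lt
  have hPlt : ∀ q ∈ P, q < p := fun q hq => by obtain ⟨x, _, rfl⟩ := (hPmem q).1 hq; exact x.val_lt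
  -- the pattern is duplicate-free
  set patt := pattPQ p P Q with hpattdef
  have hpatt_mem : ∀ w, w ∈ patt ↔ ∃ x ∈ A i, ∃ bb ∈ B i, (x.val + bb.val) % p = w := by
    intro w; rw [hpattdef, pattPQ, List.mem_flatMap]
    constructor
    · rintro ⟨xv, hxv, hw⟩
      rw [List.mem_map] at hw
      obtain ⟨q, hq, rfl⟩ := hw
      obtain ⟨x, hx, rfl⟩ := (hPmem xv).1 hxv
      obtain ⟨bb, hbb, rfl⟩ := (hQmem q).1 hq; exact ⟨x, hx, bb, hbb, rfl⟩
    · rintro ⟨x, hx, bb, hbb, rfl⟩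
      exact ⟨x.val, (hPmem _).2 ⟨x, hx, rfl⟩, List.mem_map.2 ⟨bb.val, (hQmem _).2 ⟨bb, hbb, rfl⟩, rfl⟩⟩
  have hpatt_cast : ∀ (x bb : ZMod p), ((((x.val + bb.val) % p : ℕ)) : ZMod p) = x + bb := fun x bb => by
    rw [cast_add_mod, ZMod.natCast_zmod_val, ZMod.natCast_zmod_val]
  have hpatt : patt.Nodup := by
    rw [hpattdef, pattPQ, List.nodup_flatMap]
    constructor
    · intro xv _
      refine List.Nodup.map_on (fun q hq q' hq' hqq => ?_) hQnd
      have hq1 := hQlt q hq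
      have hq2 := hQlt q' hq'
      have := congrArg (fun n : ℕ => (n : ZMod p)) hqq
      simp only [cast_add_mod, add_right_inj] at this
      have := congrArg ZMod.val this
      rwa [ZMod.val_natCast_of_lt hq1, ZMod.val_natCast_of_lt hq2] at this
    · refine hPnd.imp_of_mem ?_
      intro xv xv' hxv hxv' hne v hv hv'
      rw [List.mem_map] at hv hv'
      obtain ⟨q, hq, rfl⟩ := hv
      obtain ⟨q', hq', hqq⟩ := hv'
      obtain ⟨x, hx, rfl⟩ := (hPmem xv).1 hxv
      obtain ⟨x', hx', rfl⟩ := (hPmem xv').1 hxv'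
      obtain ⟨bb, hbb, rfl⟩ := (hQmem q).1 hq
      obtain ⟨bb', hbb', rfl⟩ := (hQmem q').1 hq'
      have hcast := congrArg (fun n : ℕ => (n : ZMod p)) hqq
      simp only [hpatt_cast] at hcast
      obtain ⟨hxx, -⟩ := add_injOn_AB hS hC i hx' hx hbb' hbb hcast; exact hne (by rw [hxx])
  -- the three sets
  set W := ((A i) ×ˢ ((B i) ×ˢ (C i))).image fun q : ZMod p × ZMod p × ZMod p => (0 : ZMod p) + q.2.2 - q.1 - q.2.1 with hW
  set SY := (A i).image (fun x => (0 : ZMod p) - x) + DU B C (univ.erase i) with hSYdef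
  set T := (B i).image (fun x => (0 : ZMod p) - x) + DU A C (univ.erase i) with hT
  have hWSY : Disjoint W SY := disjoint_W_negA_add_DU hS i
  have hTWSY : Disjoint T (W ∪ SY) := disjoint_negB_add_DU_AC hS i
  have hmemW : ∀ x ∈ A i, ∀ b ∈ B i, ∀ cc ∈ C i, cc - x - b ∈ W := fun x hx b hb cc hcc =>
    mem_image.2 ⟨(x, b, cc), mem_product.2 ⟨hx, mem_product.2 ⟨hb, hcc⟩⟩, by ring⟩
  -- the pinned cover `SY` as a mask
  set syM := P.foldl (fun m x => m ||| rot p (maskOf Yo) (p - x)) 0 with hsyMdef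
  have htb_syM : ∀ v, tb syM v = true ↔ ∃ e ∈ SY, e.val = v := fun v => tb_foldl_lor_rot_maskOf hPmem hYomem v
  have hsyM_lt : syM < 2 ^ p := by
    refine Nat.lt_pow_two_of_testBit _ fun j hj => ?_
    rw [← tb_eq_testBit, Bool.eq_false_iff]
    intro htb
    obtain ⟨e, _, hev⟩ := (htb_syM j).1 htb
    have := e.val_lt; omega
  have hsz' : popc (List.range p) syM = sz := by
    rw [← hSY, popc_eq_length_members]
    have hnd : (members (List.range p) syM).Nodup := nodup_members List.nodup_range _
    have hset : (members (List.range p) syM).toFinset = SY.image ZMod.val := by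
      ext v
      rw [List.mem_toFinset, mem_members, List.mem_range, mem_image]
      constructor
      · rintro ⟨_, htb⟩; exact (htb_syM v).1 htb
      · rintro ⟨e, he, rfl⟩; exact ⟨e.val_lt, (htb_syM _).2 ⟨e, he, rfl⟩⟩
    rw [← List.toFinset_card_of_nodup hnd, hset, card_image_of_injective _ (ZMod.val_injective p)]
  -- translates
  have htrans_mem : ∀ (r w : ℕ) (cc : ZMod p), cc.val = r → w ∈ patt →
      ∃ x ∈ A i, ∃ b ∈ B i, ((((r + p - w) % p : ℕ)) : ZMod p) = cc - x - b := by
    intro r w cc hr hw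
    obtain ⟨x, hx, b, hb, rfl⟩ := (hpatt_mem w).1 hw
    refine ⟨x, hx, b, hb, ?_⟩
    rw [cast_add_sub_mod (by have := Nat.mod_lt (x.val + b.val) hp0; omega), hpatt_cast, ← hr, ZMod.natCast_zmod_val]; ring
  set RS := (C i).image ZMod.val with hRS
  have hRSmem : ∀ r, r ∈ RS ↔ ∃ cc ∈ C i, cc.val = r := by intro r; rw [hRS, mem_image]
  obtain ⟨hsub, hlen, hadm, hmemrs⟩ := admissible_filter_transMasks_all p patt syM RS
    (by
      intro r hr
      obtain ⟨cc, _, rfl⟩ := (hRSmem r).1 hr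
      exact cc.val_lt)
    (by
      intro r hr w hw
      obtain ⟨cc, hcc, hr'⟩ := (hRSmem r).1 hr
      obtain ⟨x, hx, b, hb, hval⟩ := htrans_mem r w cc hr' hw
      have hinW : ((((r + p - w) % p : ℕ)) : ZMod p) ∈ W := by rw [hval]; exact hmemW x hx b hb cc hcc
      rw [Bool.eq_false_iff]
      intro htb
      obtain ⟨e, he, hev⟩ := (htb_syM _).1 htb
      have hee : e = ((((r + p - w) % p : ℕ)) : ZMod p) := by
        apply ZMod.val_injective p
        rw [hev, ZMod.val_natCast, Nat.mod_eq_of_lt (Nat.mod_lt _ hp0)]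
      rw [hee] at he
      exact Finset.disjoint_left.1 hWSY hinW he)
    (by
      intro r hr r' hr' hne w hw w' hw' heq
      obtain ⟨cc, hcc, hrv⟩ := (hRSmem r).1 hr
      obtain ⟨cc', hcc', hrv'⟩ := (hRSmem r').1 hr'
      obtain ⟨x, hx, b, hb, hval⟩ := htrans_mem r w cc hrv hw
      obtain ⟨x', hx', b', hb', hval'⟩ := htrans_mem r' w' cc' hrv' hw'
      rw [heq, hval'] at hval
      obtain ⟨-, -, hccc⟩ := blockSum_inj hS i hx' hx hb' hb hcc' hcc hval
      exact hne (by rw [← hrv, ← hrv', hccc]))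
  have hlen' : ((transMasks p patt).filter fun x => decide (x.1 ∈ RS)).length = c := by
    rw [hlen, hRS, Finset.card_image_of_injective _ (ZMod.val_injective p), hc]
  set rs := (transMasks p patt).filter fun x => decide (x.1 ∈ RS) with hrs
  have hleaf := caseGLeafT_of_caseGDeadT h hpatt hsz' rs hsub hlen' hadm
  -- the cover `W ∪ SY`
  set cov := rs.foldl (fun cv x => cv ||| x.2) syM with hcov
  have hcov_mem : ∀ v, tb cov v = true → ∃ e ∈ W ∪ SY, e.val = v := by
    intro v hv
    rw [hcov, tb_foldl_lor] at hv
    rcases hv with hv | ⟨x, hx, hv⟩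
    · obtain ⟨e, he, hev⟩ := (htb_syM v).1 hv
      exact ⟨e, mem_union_right _ he, hev⟩
    · obtain ⟨hx1, hxe⟩ := (hmemrs x).1 hx
      obtain ⟨cc, hcc, hrv⟩ := (hRSmem _).1 hx1
      rw [hxe] at hv
      obtain ⟨w, hw, hwv⟩ := (tb_transMask p patt x.1 _).1 hv
      obtain ⟨x', hx', b, hb, hval⟩ := htrans_mem x.1 w cc hrv hw
      refine ⟨cc - x' - b, mem_union_left _ (hmemW x' hx' b hb cc hcc), ?_⟩
      rw [← hval, ZMod.val_natCast, Nat.mod_mod, hwv]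
  have hcov_lt : cov < 2 ^ p := by
    refine Nat.lt_pow_two_of_testBit _ fun j hj => ?_
    rw [← tb_eq_testBit, Bool.eq_false_iff]
    intro htb
    obtain ⟨e, _, hev⟩ := hcov_mem j htb
    have := e.val_lt; omega
  have hM : fullMask p ^^^ cov < 2 ^ p := by
    rw [fullMask_eq]; exact Nat.xor_lt_two_pow (by have := Nat.one_le_two_pow (n := p); omega) hcov_lt
  -- `Z° ⊆` the candidate mask
  set zc := Q.foldl (fun m q => m &&& rot p (fullMask p ^^^ cov) q) (fullMask p) with hzc
  have hZmem : ∀ ζ ∈ DU A C (univ.erase i), ζ.val ∈ members (List.range p) zc := by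
    intro ζ hζ
    rw [mem_members, List.mem_range]
    refine ⟨ζ.val_lt, ?_⟩
    rw [hzc, tb_foldl_land_rot hM hQlt ζ.val_lt]
    intro q hq
    obtain ⟨b, hb, rfl⟩ := (hQmem q).1 hq
    have hlt : (ζ.val + p - b.val) % p < p := Nat.mod_lt _ hp0
    rw [tb_compl hlt, Bool.not_eq_true', Bool.eq_false_iff]
    intro htb
    obtain ⟨e, he, hev⟩ := hcov_mem _ htb
    have hecast : e = ζ - b := by
      have := congrArg (fun n : ℕ => (n : ZMod p)) hev
      simp only [ZMod.natCast_zmod_val] at this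
      rw [this, cast_add_sub_mod (by have := b.val_lt; omega), ZMod.natCast_zmod_val, ZMod.natCast_zmod_val]
    have hinT : ζ - b ∈ T := by
      have hneg : (0 : ZMod p) - b ∈ (B i).image (fun x => (0 : ZMod p) - x) := mem_image.2 ⟨b, hb, rfl⟩
      have := Finset.add_mem_add hneg hζ
      convert this using 1; ring
    rw [hecast] at he
    exact Finset.disjoint_left.1 hTWSY hinT he
  set Zo := (members (List.range p) zc).filter fun v => decide (v ∈ (DU A C (univ.erase i)).image ZMod.val) with hZo
  have hZcard : #(DU A C (univ.erase i)) = z := by rw [card_DU_AC hS hB, hz]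
  have hZomem : Zo ∈ (members (List.range p) zc).sublistsLen z := by
    rw [← hZcard, ← card_image_of_injective (DU A C (univ.erase i)) (ZMod.val_injective p)]
    exact filter_mem_sublistsLen _ (nodup_members List.nodup_range _) _ fun v hv => by
      obtain ⟨ζ, hζ, rfl⟩ := mem_image.1 hv
      exact hZmem ζ hζ
  have hZo_mem : ∀ v, v ∈ Zo ↔ ∃ ζ ∈ DU A C (univ.erase i), ζ.val = v := by
    intro v; rw [hZo, List.mem_filter, decide_eq_true_eq, mem_image]
    constructor
    · exact fun h => h.2
    · rintro ⟨ζ, hζ, rfl⟩; exact ⟨hZmem ζ hζ, ζ, hζ, rfl⟩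
  have hZo_nd : Zo.Nodup := (nodup_members List.nodup_range _).filter _
  -- the leaf puts `(Yo, Zo)` in the table
  have hmem := mem_of_caseGLeafT hleaf Zo hZomem
  exact hdead _ hmem A B C hS hA hB hC ks hks hksi hszs hYond hZo_nd hYomem hZo_mem

/-! ## §2 The sumset `SY` under the affine normalisation -/

/-- **`SY = (−Aᵢ) + Y°` is mapped affinely by the normalisation.**  If `A′ᵢ = u·Aᵢ + tA` and `DU B′ C′ I = (DU B C I).image (u·y + δ)`, then
`(−A′ᵢ) + DU B′ C′ I = ((−Aᵢ) + DU B C I).image (v ↦ u·v + (δ − tA))`. [cite: CohnKleinbergSzegedyUmans2005, Def. 5.1] -/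
theorem negImage_add_DU_eq_image_affine {N : ℕ} {A B C B' C' : Fin N → Finset (ZMod p)} {A'i : Finset (ZMod p)} (i : Fin N)
    (I : Finset (Fin N)) (u tA δ : ZMod p) (hA' : ∀ x, x ∈ A'i ↔ ∃ v ∈ A i, u * v + tA = x)
    (hDU : DU B' C' I = (DU B C I).image fun y => u * y + δ) :
    A'i.image (fun x => (0 : ZMod p) - x) + DU B' C' I =
      ((A i).image (fun x => (0 : ZMod p) - x) + DU B C I).image fun v => u * v + (δ - tA) := by
  ext w
  rw [hDU, Finset.mem_add, mem_image]
  constructor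
  · rintro ⟨na, hna, y', hy', rfl⟩
    obtain ⟨a', ha', rfl⟩ := mem_image.1 hna
    obtain ⟨v, hv, rfl⟩ := (hA' a').1 ha'
    obtain ⟨y, hy, rfl⟩ := mem_image.1 hy'
    refine ⟨(0 - v) + y, Finset.add_mem_add (mem_image.2 ⟨v, hv, rfl⟩) hy, by ring⟩
  · rintro ⟨e, he, rfl⟩
    obtain ⟨na, hna, y, hy, rfl⟩ := Finset.mem_add.1 he
    obtain ⟨v, hv, rfl⟩ := mem_image.1 hna
    refine ⟨(0 : ZMod p) - (u * v + tA), mem_image.2 ⟨u * v + tA, (hA' _).2 ⟨v, hv, rfl⟩, rfl⟩, u * y + δ,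
      mem_image.2 ⟨y, hy, rfl⟩, by ring⟩

/-! ## §3 The Hamidoune–Rødseth cell -/

/-- **SOUNDNESS in the Hamidoune–Rødseth cell `#SY = a + L`** (any number of blocks): if `Aᵢ ⊆` an `(a+1)`-term progression and `Y° ⊆` an `(L+1)`-term
progression of the same non-zero difference `d`, `#SY = a + L` and `a + L < p`, then for any base point `β₀` some hole indices `h′ ∈ [1, a]`, `k ∈ [1, L]`
make `caseGDeadT p c z (a + L) ([0,a]∖{h′}) ((a + [0,L])∖{a + k}) Q tbl` return `false` on the increasing value list `Q` of `d⁻¹·(Bᵢ − β₀)`.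
[cite: CohnKleinbergSzegedyUmans2005, Def. 5.1] [cite: HamidouneRodseth2000, main theorem (§1, p. 252)] -/
theorem caseGDeadT_false_of_HR {N : ℕ} {A B C : Fin N → Finset (ZMod p)} (hS : IsSTPP A B C)
    (hA : ∀ k, (A k).Nonempty) (hB : ∀ k, (B k).Nonempty) (hC : ∀ k, (C k).Nonempty) (i : Fin N)
    {a c L z : ℕ} (ha : #(A i) = a) (hc : #(C i) = c)
    (hz : ∑ k ∈ univ.erase i, #(A k) * #(C k) = z) (hL : ∑ k ∈ univ.erase i, #(B k) * #(C k) = L) (haL : a + L < p)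
    (h1a : 1 ≤ a) (h1L : 1 ≤ L)
    {d sA tY : ZMod p} (hd : d ≠ 0) (hAsub : A i ⊆ apFinset sA d (a + 1)) (hYsub : DU B C (univ.erase i) ⊆ apFinset tY d (L + 1))
    (hSY : #((A i).image (fun x => (0 : ZMod p) - x) + DU B C (univ.erase i)) = a + L) (β₀ : ZMod p)
    (ks : List (Fin N)) (hks : ks.Nodup) (hksi : ∀ k, k ∈ ks ↔ k ≠ i) {szs : List (ℕ × ℕ × ℕ)}
    (hszs : ks.map (fun k => (#(A k), #(B k), #(C k))) = szs)
    {tbl : List (List ℕ × List ℕ)} (hdead : ∀ e ∈ tbl, CoverDead p N i szs e.1 e.2) :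
    ∃ h' k : ℕ, 1 ≤ h' ∧ h' ≤ a ∧ 1 ≤ k ∧ k ≤ L ∧
      caseGDeadT p c z (a + L) ((List.range (a + 1)).filter fun x => !(Nat.beq x h'))
        (((List.range (L + 1)).filter fun x => !(Nat.beq x k)).map fun m => a + m)
        (((B i).image fun x => (d⁻¹ * (x - β₀)).val).sort (· ≤ ·)) tbl = false := by
  have hp0 : 0 < p := hp.out.pos
  have hYcard : #(DU B C (univ.erase i)) = L := by rw [card_DU_BC hS hA, hL]
  obtain ⟨αs, h', h'1, h'a, hAeq⟩ := exists_eq_image_erase_of_subset_apFinset hd (by omega) h1a hAsub ha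
  obtain ⟨ys, k, hk1, hkL, hYeq⟩ := exists_eq_image_erase_of_subset_apFinset hd (by omega) h1L hYsub hYcard
  refine ⟨h', k, h'1, h'a, hk1, hkL, ?_⟩
  -- the normalisation
  set u : ZMod p := d⁻¹ with hu
  have hu0 : u ≠ 0 := inv_ne_zero hd
  have hud : u * d = 1 := inv_mul_cancel₀ hd
  set t : Fin N → ZMod p := fun kk => if kk = i then -(u * αs) else 0 with ht
  have hti : t i = -(u * αs) := by simp [ht]
  set β : ZMod p := u * αs - u * β₀ with hβ
  set γ : ZMod p := (a : ZMod p) + β - u * ys with hγ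
  have hS2 : IsSTPP (fun kk => (A kk).image (u * ·)) (fun kk => (B kk).image (u * ·)) (fun kk => (C kk).image (u * ·)) :=
    isSTPP_dilate hS hu0
  have hS3 := IsSTPP.translate_shiftBC hS2 t β γ
  set A3 : Fin N → Finset (ZMod p) := fun kk => ((A kk).image (u * ·)).image (· + t kk) with hA3
  set B3 : Fin N → Finset (ZMod p) := fun kk => (((B kk).image (u * ·)).image (· + t kk)).image (· + β) with hB3
  set C3 : Fin N → Finset (ZMod p) := fun kk => (((C kk).image (u * ·)).image (· + t kk)).image (· + γ) with hC3
  have hS3' : IsSTPP A3 B3 C3 := hS3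
  have hmemA3 : ∀ kk x, x ∈ A3 kk ↔ ∃ v ∈ A kk, u * v + t kk = x := by
    intro kk x; simp only [hA3, mem_image, exists_exists_and_eq_and]
  have hmemB3 : ∀ kk x, x ∈ B3 kk ↔ ∃ v ∈ B kk, u * v + (t kk + β) = x := by
    intro kk x; simp only [hB3, mem_image, exists_exists_and_eq_and, add_assoc]
  have hmemC3 : ∀ kk x, x ∈ C3 kk ↔ ∃ v ∈ C kk, u * v + (t kk + γ) = x := by
    intro kk x; simp only [hC3, mem_image, exists_exists_and_eq_and, add_assoc]
  have hinjA : ∀ kk, Function.Injective fun v : ZMod p => u * v + t kk := fun kk v v' hh => by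
    have := mul_left_cancel₀ hu0 (add_right_cancel hh); exact this
  have hinjB : ∀ kk, Function.Injective fun v : ZMod p => u * v + (t kk + β) := fun kk v v' hh => by
    have := mul_left_cancel₀ hu0 (add_right_cancel hh); exact this
  have hinjC : ∀ kk, Function.Injective fun v : ZMod p => u * v + (t kk + γ) := fun kk v v' hh => by
    have := mul_left_cancel₀ hu0 (add_right_cancel hh); exact this
  have hA3eq : ∀ kk, A3 kk = (A kk).image fun v => u * v + t kk := fun kk => by ext x; rw [hmemA3, mem_image]
  have hB3eq : ∀ kk, B3 kk = (B kk).image fun v => u * v + (t kk + β) := fun kk => by ext x; rw [hmemB3, mem_image]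
  have hC3eq : ∀ kk, C3 kk = (C kk).image fun v => u * v + (t kk + γ) := fun kk => by ext x; rw [hmemC3, mem_image]
  have hA3ne : ∀ kk, (A3 kk).Nonempty := fun kk => by rw [hA3eq]; exact (hA _).image _
  have hB3ne : ∀ kk, (B3 kk).Nonempty := fun kk => by rw [hB3eq]; exact (hB _).image _
  have hC3ne : ∀ kk, (C3 kk).Nonempty := fun kk => by rw [hC3eq]; exact (hC _).image _
  have hcardA : ∀ kk, #(A3 kk) = #(A kk) := fun kk => by rw [hA3eq, card_image_of_injective _ (hinjA kk)]
  have hcardB : ∀ kk, #(B3 kk) = #(B kk) := fun kk => by rw [hB3eq, card_image_of_injective _ (hinjB kk)]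
  have hcardC : ∀ kk, #(C3 kk) = #(C kk) := fun kk => by rw [hC3eq, card_image_of_injective _ (hinjC kk)]
  have hc3 : #(C3 i) = c := by rw [hcardC, hc]
  have hz3 : ∑ kk ∈ univ.erase i, #(A3 kk) * #(C3 kk) = z := by
    rw [← hz]; exact Finset.sum_congr rfl fun kk _ => by rw [hcardA, hcardC]
  have hszs3 : ks.map (fun kk => (#(A3 kk), #(B3 kk), #(C3 kk))) = szs := by
    rw [← hszs]; exact List.map_congr_left fun kk _ => by rw [hcardA, hcardB, hcardC]
  -- normal-form data: `A3 i`, `Y°3`, `#SY3`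
  have hA3i : A3 i = ((range (a + 1)).erase h').image fun kk : ℕ => (kk : ZMod p) := by
    ext x
    rw [hmemA3, hAeq, hti, mem_image]
    constructor
    · rintro ⟨v, hv, rfl⟩
      obtain ⟨kk, hkk, rfl⟩ := mem_image.1 hv
      exact ⟨kk, hkk, by linear_combination (-(kk : ZMod p)) * hud⟩
    · rintro ⟨kk, hkk, rfl⟩
      exact ⟨αs + (kk : ZMod p) * d, mem_image.2 ⟨kk, hkk, rfl⟩, by linear_combination (kk : ZMod p) * hud⟩
  have hY3 : DU B3 C3 (univ.erase i) = (DU B C (univ.erase i)).image fun y => u * y + (γ - β) :=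
    DU_eq_image_affine u (γ - β) (fun kk => t kk + β) (fun kk => t kk + γ) (fun kk => by ring) hmemB3 hmemC3 _
  have hY3' : DU B3 C3 (univ.erase i) = ((range (L + 1)).erase k).image fun m : ℕ => (a : ZMod p) + (m : ZMod p) := by
    rw [hY3, hYeq, image_image]
    refine image_congr fun m _ => ?_
    show u * (ys + (m : ZMod p) * d) + (γ - β) = (a : ZMod p) + (m : ZMod p)
    rw [hγ]; linear_combination (m : ZMod p) * hud
  have hSY3 : #((A3 i).image (fun x => (0 : ZMod p) - x) + DU B3 C3 (univ.erase i)) = a + L := by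
    rw [negImage_add_DU_eq_image_affine (A := A) i (univ.erase i) u (t i) (γ - β) (hmemA3 i) hY3,
      card_image_of_injective _ (fun v v' hh => mul_left_cancel₀ hu0 (add_right_cancel hh)), hSY]
  -- the value lists
  set PL : List ℕ := (List.range (a + 1)).filter fun x => !(Nat.beq x h') with hPL
  set YL : List ℕ := ((List.range (L + 1)).filter fun x => !(Nat.beq x k)).map fun m => a + m with hYL
  have hfilt : ∀ (n hh kk : ℕ), kk ∈ (List.range (n + 1)).filter (fun x => !(Nat.beq x hh)) ↔ kk < n + 1 ∧ kk ≠ hh := by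
    intro n hh kk
    rw [List.mem_filter, List.mem_range]
    constructor
    · rintro ⟨hkk, hne⟩
      exact ⟨hkk, fun hkh => by rw [hkh, Nat.beq_refl] at hne; exact Bool.noConfusion hne⟩
    · rintro ⟨hkk, hne⟩
      refine ⟨hkk, ?_⟩
      cases hq : Nat.beq kk hh
      · rfl
      · exact absurd (Nat.eq_of_beq_eq_true hq) hne
  have hPLmem : ∀ v, v ∈ PL ↔ ∃ x ∈ A3 i, x.val = v := by
    intro v
    rw [hPL, hfilt, hA3i]
    constructor
    · rintro ⟨hv, hne⟩
      exact ⟨(v : ZMod p), mem_image.2 ⟨v, mem_erase.2 ⟨hne, mem_range.2 hv⟩, rfl⟩, ZMod.val_natCast_of_lt (by omega)⟩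
    · rintro ⟨x, hx, rfl⟩
      obtain ⟨kk, hkk, rfl⟩ := mem_image.1 hx
      rw [mem_erase, mem_range] at hkk
      rw [ZMod.val_natCast_of_lt (by omega)]
      exact ⟨hkk.2, hkk.1⟩
  have hPLnd : PL.Nodup := List.nodup_range.filter _
  have hYLmem : ∀ v, v ∈ YL ↔ ∃ e ∈ DU B3 C3 (univ.erase i), e.val = v := by
    intro v
    rw [hYL, List.mem_map, hY3']
    constructor
    · rintro ⟨m, hm, rfl⟩
      rw [hfilt] at hm
      refine ⟨(a : ZMod p) + (m : ZMod p), mem_image.2 ⟨m, mem_erase.2 ⟨hm.2, mem_range.2 hm.1⟩, rfl⟩, ?_⟩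
      rw [← Nat.cast_add, ZMod.val_natCast_of_lt (by omega)]
    · rintro ⟨e, he, rfl⟩
      obtain ⟨m, hm, rfl⟩ := mem_image.1 he
      rw [mem_erase, mem_range] at hm
      refine ⟨m, (hfilt _ _ _).2 ⟨hm.2, hm.1⟩, ?_⟩
      rw [← Nat.cast_add, ZMod.val_natCast_of_lt (by omega)]
  have hYLnd : YL.Nodup := by
    rw [hYL]
    exact (List.nodup_range.filter _).map fun m m' hmm => Nat.add_left_cancel hmm
  obtain ⟨hQmem, hQnd, -, -⟩ := valList_spec (B3 i)
  have key := caseGDeadT_false_of_normal_form_lists hS3' hA3ne hB3ne hC3ne i hc3 hz3 hSY3 PL _ YL hPLmem hPLnd hQmem hQnd hYLmem hYLnd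
    ks hks hksi hszs3 hdead
  have hB3i : (B3 i).image ZMod.val = (B i).image fun x => (d⁻¹ * (x - β₀)).val := by
    rw [hB3eq, image_image]
    refine image_congr fun x _ => ?_
    show (u * x + (t i + β)).val = (d⁻¹ * (x - β₀)).val
    rw [hti, hβ, hu]; congr 1; ring
  rw [hB3i] at key
  exact key

end Summit.MatrixMultiplication.OmegaCensus.CubeNB.S2
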